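import Summits.QuantumFields.BalabanUV.Gaps.EndDrawdownEverySlope
import Summits.QuantumFields.BalabanUV.Gaps.EndDrawdownCooperator
import Literature.MathematicalPhysics.QuantumFieldTheory.Balaban1983to89.T4ContinuumYM4Torus

/-!
# Gaps / EndDrawdownEverySlopeDecided — THE EVERY-SLOPE ROAD AT END GRADE IS DECIDED BY THE DRAWDOWN SLOPE, FOR EVERY ONE-LOOP SEQUENCE:
# both outer links of `EndDrawdownEverySlope.everySlope_chain` are EQUIVALENCES with NO sign hypothesis —
#   `EndForcedES b γc ⟺ ∃ r > 0, DwSeq b r`      (gen 8's `EndDrawdownEverySlopeExact` had this only for `b ≥ 0`),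
#   `EndPossibleES b γc ⟺ ∀ ε > 0, DwSeq b (−ε)`  (new; the third link `DwSeq b 0 ⟹ POSSIBLE` is STRICT: `b_j = −1∕(j+1)`),
# so over the every-slope realization class the END statement reads of the one-loop coefficients `b = β⁰` exactly ONE extended real, the
# drawdown slope `r⋆(b) := sup {r : DwSeq b r}`: FORCED iff `r⋆ > 0`, POSSIBLE iff `r⋆ ≥ 0` (as a limit of negative thresholds), and the
# band in between is the single boundary value `r⋆ = 0` (attained — `b ≡ 0` — or not — the harmonic tail).  In a drift class (row (D1)'s shape)
# FORCED ⟺ `0 < L` and POSSIBLE ⟺ `0 ≤ L`; for a merely convergent one-loop part FORCED ⟺ `0 < lim` and POSSIBLE ⟺ `0 ≤ lim`; at the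
# β-lead's pinned literal FORCED ⟺ `0 < M∞` HYPOTHESIS-FREE; and the every-slope road is the INTERIOR LIMIT of `EndDrawdownBand`'s band:
# FORCED_ES ⟺ ∃ rlo > 0 FORCED_[−rlo,rhi], POSSIBLE_ES ⟺ ∀ rhi > 0 POSSIBLE_[−rlo,rhi]; §6 transports the sandwich to Bałaban's datum and
# the print-faithful T⁴ headline (`continuumYM4Torus_of_dwSeq_pos_everySlope`: on the every-slope road the headline's one-loop input is ONE
# positive drawdown threshold).  Mechanism: the profile realizations of
# `Gaps/EndDrawdownProfile` (tuned adversary) and `Gaps/EndDrawdownCooperator` (tuned cooperator, shooting with a two-level barrier)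
# (this seat's own leaf; cell pub-balaban-gaps, seat g1-p3 GEN 9, rows CAP ∕ tail «split ∕ weakening»; file 12 of «the one-loop interface of
# the END statement»)

HONEST FRAMING (cell rule, page 1 of everything): two- to six-line compositions of tree theorems over hypothesis SHAPES (`EverySlope`, `DwSeq`,
`OneLoopDrift`, `EndpointExistence`) with the two hypothesis-free toy witnesses; `EndForcedES` ∕ `EndPossibleES` are quantified READINGS of the
cell's END-grade statement over Bałaban-free data `(b, γc)`, not binders; for Bałaban's split `EverySlope` is row (D4)'s located UNPRINTED
currency and the drawdown slope of the table's `β⁰` is rows CAP ∕ tail ∕ (D1)'s unprinted input (at the pinned literal: the SIGN of `M∞`; no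
value or sign certified, NODE-O instance 0∕1).  What the file says about rows CAP ∕ tail (words ∕ odds UNCHANGED): at END grade on the
every-slope road NO finite list of one-loop coefficients and NO sign pattern is read — forcing and possibility are decided by the drawdown slope
alone.  Nothing of Bałaban's is asserted; 0∕6 binders; one finite T⁴; NOT [I] Thm 2, NOT `BetaPertH`, NOT the continuum limit, NOT Clay.

CITATION HEADER (tags CONTEXT ONLY).  [I] = T. Bałaban, Commun. Math. Phys. **109** (1987) 249–301 [Balaban1987RG1]: (0.20) p. 256, Thm 2
p. 259 (first sentence), Thm 3 p. 264, (1.22) p. 264, (2.12)–(2.14) p. 268.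
-/

namespace Summit.QuantumFields.BalabanUV.Gaps.EndDrawdownEverySlopeDecided

open Literature.MathematicalPhysics.QuantumFieldTheory.Balaban1983to89
open Literature.MathematicalPhysics.QuantumFieldTheory.Balaban1983to89.FlowStep
open Literature.MathematicalPhysics.QuantumFieldTheory.Balaban1983to89.FlowStepRuns
open Literature.MathematicalPhysics.QuantumFieldTheory.Balaban1983to89.DagBinding
open Literature.MathematicalPhysics.QuantumFieldTheory.Balaban1983to89.Beta.Drift (OneLoopDrift)
open Literature.MathematicalPhysics.QuantumFieldTheory.Balaban1983to89.Beta.RateCertificate (CauchyRate)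
open Literature.MathematicalPhysics.QuantumFieldTheory.Balaban1983to89.Beta.OneStepKernelFamily (TbalOf)
open Literature.MathematicalPhysics.QuantumFieldTheory.Balaban1983to89.Beta.AffineAveraging (box)
open Summit.QuantumFields.BalabanUV.Beta.MixedJetTablesPlug (JsBalAn1)
open Summit.QuantumFields.BalabanUV.Beta.GAN24.StencilSlotOfE3 (one_le_of_two_le)
open Summit.QuantumFields.BalabanUV.Gaps.CapSignsConstRoad (EverySlope)
open Summit.QuantumFields.BalabanUV.Gaps.CapTailPinnedLimitSign (exists_geomRate_pinned)
open Summit.QuantumFields.BalabanUV.Gaps.EndDrawdownSeq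
open Summit.QuantumFields.BalabanUV.Gaps.EndDrawdownBand
open Summit.QuantumFields.BalabanUV.Gaps.EndDrawdownEverySlope
open Summit.QuantumFields.BalabanUV.Gaps.EndDrawdownProfile
open Summit.QuantumFields.BalabanUV.Gaps.EndDrawdownCooperator
open Literature.MathematicalPhysics.QuantumFieldTheory.Balaban1983to89.T4Continuum
open Literature.MathematicalPhysics.QuantumFieldTheory.Balaban1983to89.T4ContinuumYM4Torus
open Filter Topology Finset

universe u

noncomputable section

variable {b : ℕ → ℝ}

/-! ## §1 Dyadic reductions of the two drawdown conditions -/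

/-- `∃ r > 0, DwSeq b r ⟺ ∃ n, DwSeq b 2⁻ⁿ` (monotonicity in the threshold). [folklore] -/
theorem exists_dwSeq_pos_iff : (∃ r : ℝ, 0 < r ∧ DwSeq b r) ↔ ∃ n : ℕ, DwSeq b (((2 : ℝ)⁻¹) ^ n) := by
  constructor
  · rintro ⟨r, hr, hDw⟩
    obtain ⟨n, hn⟩ := exists_inv_two_pow_lt hr
    exact ⟨n, dwSeq_mono hDw hn.le⟩
  · rintro ⟨n, hDw⟩
    exact ⟨_, pow_pos (by norm_num) n, hDw⟩

/-- `∀ ε > 0, DwSeq b (−ε) ⟺ ∀ n, DwSeq b (−2⁻ⁿ)`. [folklore] -/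
theorem forall_dwSeq_neg_iff : (∀ ε : ℝ, 0 < ε → DwSeq b (-ε)) ↔ ∀ n : ℕ, DwSeq b (-(((2 : ℝ)⁻¹) ^ n)) := by
  constructor
  · exact fun h n => h _ (pow_pos (by norm_num) n)
  · intro h ε hε
    obtain ⟨n, hn⟩ := exists_inv_two_pow_lt hε
    exact dwSeq_mono (h n) (by linarith)

/-! ## §2 FORCED over the every-slope class ⟺ a positive drawdown threshold — NO sign hypothesis -/

/-- **THEOREM A · `EndForcedES b γc ⟺ ∃ r > 0, DwSeq b r`** for EVERY real sequence `b` and `0 < γc`.  ⟸ is gen 8's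
`endForcedES_of_dwSeq_pos`; ⟹: if `b` has bounded drawdown below no line of positive slope, the TUNED ADVERSARY of `Gaps/EndDrawdownProfile`
is an every-slope realization of `b` without `EndpointExistence`.  Removes the hypothesis `b ≥ 0` of `EndDrawdownEverySlopeExact`.
[cite: Balaban1987RG1, Thm 2 p.259 (first sentence) and Thm 3 p.264] -/
theorem endForcedES_iff_dwSeq_pos {γc : ℝ} (hγc : 0 < γc) : EndForcedES b γc ↔ ∃ r : ℝ, 0 < r ∧ DwSeq b r := by
  refine ⟨fun hF => ?_, fun ⟨_, hr, hDw⟩ => endForcedES_of_dwSeq_pos hr hDw⟩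
  by_contra hno
  have hall : ∀ n : ℕ, ¬ DwSeq b (((2 : ℝ)⁻¹) ^ n) := fun n hn => hno (exists_dwSeq_pos_iff.mpr ⟨n, hn⟩)
  obtain ⟨β, Sβ, hb, hES, hcont, hgen, hnotE⟩ := exists_everySlope_realization_not_endpointExistence hall hγc
  exact hnotE (hF β Sβ _ hb hES (hcont γc) hgen)

/-- ¬FORCED, WITNESSED · if `b` has bounded drawdown below no line of positive slope then some every-slope realization of `b` (any box, (C)
everywhere, the tree's canonical construction) has NO `EndpointExistence`. [cite: Balaban1987RG1, Thm 2 p.259 (first sentence) and Thm 3 p.264] -/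
theorem exists_realization_not_endpointExistence (h : ∀ r : ℝ, 0 < r → ¬ DwSeq b r) {γc : ℝ} (hγc : 0 < γc) :
    ∃ (β : HBeta) (Sβ : B12Beta.OneLoopSplit β), (∀ j, Sβ.β0 j = b j) ∧ EverySlope Sβ γc ∧ (∀ γ, BetaContH γ β) ∧
      ForwardGenerated (modelOf β) β ∧ ¬ EndpointExistence (modelOf β) :=
  exists_everySlope_realization_not_endpointExistence (fun n => h _ (pow_pos (by norm_num) n)) hγc

/-! ## §3 POSSIBLE over the every-slope class ⟺ bounded drawdown below every negative line -/

/-- **THEOREM B · `EndPossibleES b γc ⟺ ∀ ε > 0, DwSeq b (−ε)`** for EVERY real sequence `b` and `0 < γc`.  ⟹ is gen 8's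
`dwSeq_neg_of_endPossibleES`; ⟸: the TUNED COOPERATOR of `Gaps/EndDrawdownCooperator` is an every-slope realization of `b` with
`EndpointExistence`.  Closes the fourth link of `everySlope_chain` as an equivalence. [cite: Balaban1987RG1, Thm 2 p.259 (first sentence) and Thm 3 p.264] -/
theorem endPossibleES_iff_dwSeq_neg {γc : ℝ} (hγc : 0 < γc) : EndPossibleES b γc ↔ ∀ ε : ℝ, 0 < ε → DwSeq b (-ε) := by
  refine ⟨fun h ε hε => dwSeq_neg_of_endPossibleES h hε, fun h => ?_⟩
  obtain ⟨β, Sβ, hb, hES, hcont, hgen, hE⟩ := exists_everySlope_realization_endpointExistence (forall_dwSeq_neg_iff.mp h) hγc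
  exact ⟨β, Sβ, _, hb, hES, hcont γc, hgen, hE⟩

/-- THE THIRD LINK IS STRICT · the harmonic tail `b_j = −1∕(j+1)` is POSSIBLE over the every-slope class (its limit is `0`, so `DwSeq b (−ε)` for
every `ε > 0`) but has UNBOUNDED drawdown below the `0`-line: `DwSeq b 0 ⟹ EndPossibleES b γc` does not reverse. [folklore] -/
theorem possible_not_dwSeq_zero {γc : ℝ} (hγc : 0 < γc) :
    EndPossibleES (fun j : ℕ => (0 : ℝ) - 1 / ((j : ℝ) + 1)) γc ∧ ¬ DwSeq (fun j : ℕ => (0 : ℝ) - 1 / ((j : ℝ) + 1)) 0 :=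
  ⟨(endPossibleES_iff_dwSeq_neg hγc).mpr fun _ hε => dwSeq_of_tendsto_lt (tendsto_harmonicBelow 0) (by linarith),
    not_dwSeq_harmonicBelow 0⟩

/-- **THE EVERY-SLOPE CHAIN, SHARP** (`0 < γc`): the outer links of `everySlope_chain` are equivalences for every `b`, the inner links are strict
(`b ≡ 0`: `DwSeq b 0` yet not FORCED — gen 8's `not_endForcedES_zero`; the harmonic tail: POSSIBLE yet not `DwSeq b 0`).
[cite: Balaban1987RG1, Thm 2 p.259 (first sentence) and Thm 3 p.264] -/
theorem everySlope_chain_sharp {γc : ℝ} (hγc : 0 < γc) :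
    (∀ b : ℕ → ℝ, EndForcedES b γc ↔ ∃ r : ℝ, 0 < r ∧ DwSeq b r) ∧
      (∀ b : ℕ → ℝ, EndPossibleES b γc ↔ ∀ ε : ℝ, 0 < ε → DwSeq b (-ε)) ∧
      (∃ b : ℕ → ℝ, DwSeq b 0 ∧ ¬ EndForcedES b γc) ∧ (∃ b : ℕ → ℝ, EndPossibleES b γc ∧ ¬ DwSeq b 0) :=
  ⟨fun _ => endForcedES_iff_dwSeq_pos hγc, fun _ => endPossibleES_iff_dwSeq_neg hγc, ⟨_, not_endForcedES_zero hγc⟩,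
    ⟨_, possible_not_dwSeq_zero hγc⟩⟩

/-- FORCED ⟹ POSSIBLE over the every-slope class, with the gap quantified: FORCED needs SOME positive threshold, POSSIBLE needs ALL negative ones.
[folklore] -/
theorem endPossibleES_of_endForcedES {γc : ℝ} (hγc : 0 < γc) (h : EndForcedES b γc) : EndPossibleES b γc := by
  obtain ⟨r, hr, hDw⟩ := (endForcedES_iff_dwSeq_pos hγc).mp h
  exact (endPossibleES_iff_dwSeq_neg hγc).mpr fun ε hε => dwSeq_mono hDw (by linarith)

/-! ## §4 Drift classes and convergent one-loop parts: the SIGN of the slope ∕ limit decides, hypothesis-free -/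

/-- **IN A DRIFT CLASS, FORCED ⟺ `0 < L`** for EVERY `b` in the class (no sign hypothesis; boundary EXCLUDED).
[cite: Balaban1987RG1, Thm 2 p.259 (first sentence) and (1.22) p.264] -/
theorem endForcedES_iff_slope_pos {γc L A : ℝ} (hγc : 0 < γc) (hA : OneLoopDrift L A b) : EndForcedES b γc ↔ 0 < L := by
  rw [endForcedES_iff_dwSeq_pos hγc]
  constructor
  · rintro ⟨r, hr, hDw⟩
    exact hr.trans_le ((dwSeq_iff_of_oneLoopDrift hA r).mp hDw)
  · exact fun hL => ⟨L, hL, dwSeq_of_oneLoopDrift hA le_rfl⟩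

/-- IN A DRIFT CLASS THE BAND IS THE BOUNDARY · POSSIBLE-and-not-FORCED ⟺ `L = 0`, for every `b` in the class.
[cite: Balaban1987RG1, Thm 2 p.259 (first sentence) and (1.22) p.264] -/
theorem band_iff_slope_zero {γc L A : ℝ} (hγc : 0 < γc) (hA : OneLoopDrift L A b) :
    (EndPossibleES b γc ∧ ¬ EndForcedES b γc) ↔ L = 0 := by
  rw [endPossibleES_iff_of_oneLoopDrift hγc hA, endForcedES_iff_slope_pos hγc hA, not_lt]
  exact ⟨fun ⟨h1, h2⟩ => le_antisymm h2 h1, fun h => ⟨h.symm.le, h.le⟩⟩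

/-- **CONVERGENT ONE-LOOP PART: FORCED ⟺ `0 < lim`** (mere convergence, no rate, no sign hypothesis).
[cite: Balaban1987RG1, Thm 2 p.259 (first sentence) and (1.22) p.264] -/
theorem endForcedES_iff_lim_pos {γc binf : ℝ} (hγc : 0 < γc) (hlim : Tendsto b atTop (𝓝 binf)) : EndForcedES b γc ↔ 0 < binf := by
  rw [endForcedES_iff_dwSeq_pos hγc]
  constructor
  · rintro ⟨r, hr, hDw⟩
    exact hr.trans_le (not_lt.mp fun hlt => not_dwSeq_of_tendsto_gt hlim hlt hDw)
  · exact fun hpos => ⟨binf / 2, half_pos hpos, dwSeq_of_tendsto_lt hlim (half_lt_self hpos)⟩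

/-- **CONVERGENT ONE-LOOP PART: POSSIBLE ⟺ `0 ≤ lim`** (mere convergence; the boundary `lim = 0` INCLUDED — by the cooperator, although
`DwSeq b 0` may fail there). [cite: Balaban1987RG1, Thm 2 p.259 (first sentence) and (1.22) p.264] -/
theorem endPossibleES_iff_lim_nonneg {γc binf : ℝ} (hγc : 0 < γc) (hlim : Tendsto b atTop (𝓝 binf)) :
    EndPossibleES b γc ↔ 0 ≤ binf := by
  rw [endPossibleES_iff_dwSeq_neg hγc]
  constructor
  · intro h
    refine le_of_not_gt fun hneg => ?_
    exact not_dwSeq_of_tendsto_gt hlim (by linarith : binf < -(-binf / 2)) (h _ (by linarith))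
  · exact fun h ε hε => dwSeq_of_tendsto_lt hlim (by linarith)

/-- **AT THE β-LEAD's PINNED LITERAL, HYPOTHESIS-FREE: FORCED ⟺ `0 < M∞`** (the table's one-loop sequence lies in the drift class of slope
`M∞ := CauchyRate.lim β⁰_table`, gen 5's `exists_geomRate_pinned`): sharpens gen 8's `everySlope_pinned_sign` (`0 < M∞ ⟹ FORCED ⟹ 0 ≤ M∞`)
to a decision and drops the sign list `hsign` of `EndDrawdownEverySlopeExact.endForcedES_pinned_iff_of_signs`.  No value or sign of `M∞` is
certified. [cite: Balaban1987RG1, Thm 2 p.259 (first sentence) and (1.22) p.264] -/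
theorem endForcedES_pinned_iff {Lc : ℕ} [NeZero Lc] (hLc : 2 ≤ Lc) {r : Fin (3 + 1) → ℕ} (hr : r ∈ box (3 + 1) Lc) (cE cVH cΛ cB : ℝ)
    (Tc : Fin 4 → Fin 4 → Fin 4 → Fin 4 → ℝ) (μ ν : Fin 4) {γc : ℝ} (hγc : 0 < γc) :
    EndForcedES (fun j => B12Beta.secondMoment
        (TbalOf Lc (JsBalAn1 (one_le_of_two_le hLc) hr cE cVH cΛ ((Lc : ℝ) ^ (2 * (3 + 1))) cB Tc) j) μ ν) γc ↔
      0 < CauchyRate.lim fun j =>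
        B12Beta.secondMoment (TbalOf Lc (JsBalAn1 (one_le_of_two_le hLc) hr cE cVH cΛ ((Lc : ℝ) ^ (2 * (3 + 1))) cB Tc) j) μ ν := by
  obtain ⟨c₀, θ, hθ0, hθ1, hG⟩ := exists_geomRate_pinned hLc hr cE cVH cΛ cB Tc μ ν
  exact endForcedES_iff_slope_pos hγc (hG.drift hθ0 hθ1)

/-! ## §5 The every-slope road is the INTERIOR LIMIT of the remainder band of `Gaps/EndDrawdownBand` -/

/-- **FORCED_ES ⟺ ∃ rlo > 0, FORCED over `[−rlo, rhi]`** (any `rhi ≥ 0`, any box `]0,γ₀]`, `0 < γ₀`, `0 < γc`): forcing over the every-slope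
class is forcing over SOME band of positive lower width (`EndDrawdownBand.endForcedLU_iff_dwSeq`). [cite: Balaban1987RG1, Thm 2 p.259 (first sentence) and Thm 3 p.264] -/
theorem endForcedES_iff_exists_endForcedLU {γc γ₀ rhi : ℝ} (hγc : 0 < γc) (hγ₀ : 0 < γ₀) (hrhi : 0 ≤ rhi) :
    EndForcedES b γc ↔ ∃ rlo : ℝ, 0 < rlo ∧ EndForcedLU b rlo rhi γ₀ := by
  rw [endForcedES_iff_dwSeq_pos hγc]
  exact exists_congr fun rlo => and_congr_right fun hrlo => (endForcedLU_iff_dwSeq hγ₀ (by linarith)).symm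

/-- **POSSIBLE_ES ⟺ ∀ rhi > 0, POSSIBLE over `[−rlo, rhi]`** (any `rlo ≥ 0`, any box `]0,γ₀]`): possibility over the every-slope class is
possibility over EVERY band of positive upper width (`EndDrawdownBand.endPossibleLU_iff_dwSeq_neg`). [cite: Balaban1987RG1, Thm 2 p.259 (first sentence) and Thm 3 p.264] -/
theorem endPossibleES_iff_forall_endPossibleLU {γc γ₀ rlo : ℝ} (hγc : 0 < γc) (hγ₀ : 0 < γ₀) (hrlo : 0 ≤ rlo) :
    EndPossibleES b γc ↔ ∀ rhi : ℝ, 0 < rhi → EndPossibleLU b rlo rhi γ₀ := by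
  rw [endPossibleES_iff_dwSeq_neg hγc]
  exact forall₂_congr fun rhi hrhi => (endPossibleLU_iff_dwSeq_neg hγ₀ (by linarith)).symm

/-- THE EVERY-SLOPE ROAD DOES NOT DEPEND ON THE BOX · FORCED and POSSIBLE over the every-slope class are the same on every `γc > 0`. [folklore] -/
theorem everySlope_box_free {γc γc' : ℝ} (hγc : 0 < γc) (hγc' : 0 < γc') :
    (EndForcedES b γc ↔ EndForcedES b γc') ∧ (EndPossibleES b γc ↔ EndPossibleES b γc') := by
  rw [endForcedES_iff_dwSeq_pos hγc, endForcedES_iff_dwSeq_pos hγc', endPossibleES_iff_dwSeq_neg hγc,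
    endPossibleES_iff_dwSeq_neg hγc']
  exact ⟨Iff.rfl, Iff.rfl⟩

/-- THE CAP IS END-IRRELEVANT ON THE EVERY-SLOPE ROAD, FOR FORCING AND FOR POSSIBILITY · two one-loop sequences that agree from `k₀` on are
forced ∕ possible over the every-slope class together — NO finite list of one-loop coefficients (no CAP sign list, no sign pattern at all) is read
at END grade (`EndDrawdownSeq.dwSeq_iff_of_eventuallyEq`). [folklore] -/
theorem everySlope_cap_free {b b' : ℕ → ℝ} {k₀ : ℕ} (heq : ∀ j, k₀ ≤ j → b' j = b j) {γc : ℝ} (hγc : 0 < γc) :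
    (EndForcedES b' γc ↔ EndForcedES b γc) ∧ (EndPossibleES b' γc ↔ EndPossibleES b γc) := by
  rw [endForcedES_iff_dwSeq_pos hγc, endForcedES_iff_dwSeq_pos hγc, endPossibleES_iff_dwSeq_neg hγc,
    endPossibleES_iff_dwSeq_neg hγc]
  exact ⟨exists_congr fun r => and_congr_right fun _ => dwSeq_iff_of_eventuallyEq heq r,
    forall₂_congr fun ε _ => dwSeq_iff_of_eventuallyEq heq (-ε)⟩

/-! ## §6 At Bałaban's datum and at the print-faithful T⁴ headline, on the every-slope road -/

section Datum

variable {F : T4Family} {G : Type u} [GaugeGroup G] [MeasurableSpace G] [HaarData G]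

/-- **END OF THE DATUM ON THE EVERY-SLOPE ROAD** · a printed split `Sβ` of `D.βfun` on the every-slope road on `]0,γc]`, (C) on the `]0,γc]`-boxes,
and ONE positive drawdown threshold `DwSeq β⁰ r`, `r > 0` ⟹ `EndpointExistence D.C.toB12` (gen 8's `endpointExistence_of_dwSeq_pos_everySlope` with
forward generation = the field `D.fwd`).  By §2 nothing weaker of `β⁰` can suffice over the class. [cite: Balaban1987RG1, Thm 2 p.259 (first sentence) and Thm 3 p.264] -/
theorem endpointExistence_datum_of_dwSeq_pos_everySlope (D : FiniteEpsData F G) (Sβ : B12Beta.OneLoopSplit D.βfun) {γc r : ℝ}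
    (hES : EverySlope Sβ γc) (hr : 0 < r) (hDw : DwSeq Sβ.β0 r) (hcont : BetaContH γc D.βfun) : EndpointExistence D.C.toB12 :=
  endpointExistence_of_dwSeq_pos_everySlope D.fwd Sβ hES hr hDw hcont

/-- NECESSITY AT THE DATUM on the every-slope road · `EndpointExistence D.C.toB12` ⟹ `DwSeq β⁰ (−ε)` for every `ε > 0`; by §3 nothing stronger of
`β⁰` follows over the class. [cite: Balaban1987RG1, (0.20) p.256 and Thm 2 p.259] -/
theorem dwSeq_neg_of_endpointExistence_datum_everySlope (D : FiniteEpsData F G) (Sβ : B12Beta.OneLoopSplit D.βfun) {γc : ℝ}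
    (hES : EverySlope Sβ γc) (hE : EndpointExistence D.C.toB12) {ε : ℝ} (hε : 0 < ε) : DwSeq Sβ.β0 (-ε) :=
  dwSeq_neg_of_endpointExistence_everySlope D.fwd Sβ hES hE hε

end Datum

section DatumSU

variable {F : T4Family} {N : ℕ} [NeZero N]

/-- **THE PRINT-FAITHFUL T⁴ HEADLINE ON THE EVERY-SLOPE ROAD** (`continuumYM4_torus_of_endpointExistence_nonvacuous` BY NAME).  Printed-averaged datum
on `SU(N)`; binders: (B), a printed split of `D.βfun` on the every-slope road on `]0,γc]` (row (D4)'s located currency), (C) on the `]0,γc]`-boxes, ONE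
positive drawdown threshold `DwSeq β⁰ r` (`r > 0`) — by §2 the EXACT one-loop input over the class: no sign list, no floor, no rate, no pin, no (UP) —
and the spine slot under the END binder; conclusion `ContinuumYM4Torus D ∧ ContinuumYM4TorusE D`.  Decides nothing (binders; instance 0∕1; one finite
T⁴; NOT Clay). [cite: Balaban1987RG1, Thm 2 p.259 (first sentence) and Thm 3 p.264] -/
theorem continuumYM4Torus_of_dwSeq_pos_everySlope (D : FiniteEpsData F (Matrix.specialUnitaryGroup (Fin N) ℂ)) (hD : D.IsPrintedAveraged)
    (hB : B16.EndStatementBPrinted D.C) (Sβ : B12Beta.OneLoopSplit D.βfun) {γc r : ℝ} (hES : EverySlope Sβ γc) (hr : 0 < r)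
    (hDw : DwSeq Sβ.β0 r) (hcont : BetaContH γc D.βfun) (hNE : T4ApexHybrid.HybridNE7Under D (EndpointExistence D.C.toB12)) :
    ContinuumYM4Torus D ∧ ContinuumYM4TorusE D :=
  continuumYM4_torus_of_endpointExistence_nonvacuous D hD hB (endpointExistence_datum_of_dwSeq_pos_everySlope D Sβ hES hr hDw hcont) hNE

/-- … IN A DRIFT CLASS (row (D1)'s shape) with POSITIVE slope `0 < L` — the SIGN of the slope is the headline's one-loop input on this road.
[cite: Balaban1987RG1, Thm 2 p.259 (first sentence) and (1.22) p.264] -/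
theorem continuumYM4Torus_of_slope_pos_everySlope (D : FiniteEpsData F (Matrix.specialUnitaryGroup (Fin N) ℂ)) (hD : D.IsPrintedAveraged)
    (hB : B16.EndStatementBPrinted D.C) (Sβ : B12Beta.OneLoopSplit D.βfun) {γc L A : ℝ} (hES : EverySlope Sβ γc)
    (hA : OneLoopDrift L A Sβ.β0) (hL : 0 < L) (hcont : BetaContH γc D.βfun)
    (hNE : T4ApexHybrid.HybridNE7Under D (EndpointExistence D.C.toB12)) : ContinuumYM4Torus D ∧ ContinuumYM4TorusE D :=
  continuumYM4Torus_of_dwSeq_pos_everySlope D hD hB Sβ hES hL (dwSeq_of_oneLoopDrift hA le_rfl) hcont hNE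

/-- **THE PRINT-FAITHFUL T⁴ HEADLINE AT THE β-LEAD's PINNED LITERAL, ON THE EVERY-SLOPE ROAD** · printed-averaged datum on `SU(N)` whose printed
split has the PINNED one-loop sequence `β⁰_j = secondMoment (TbalOf Lc (JsBalAn1 …) j) μ ν` (hypothesis `hpin` — an identification, not certified),
on the every-slope road on `]0,γc]`, with (C); then the SIGN `0 < M∞ := CauchyRate.lim β⁰` is the headline's ENTIRE one-loop input (the drift class
is hypothesis-free: gen 5's `exists_geomRate_pinned`), and by `endForcedES_pinned_iff` nothing weaker of the table forces E over the class.  No value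
or sign of `M∞` is certified (NODE-O 0∕1). [cite: Balaban1987RG1, Thm 2 p.259 (first sentence) and (1.22) p.264] -/
theorem continuumYM4Torus_pinned_of_limPos_everySlope (D : FiniteEpsData F (Matrix.specialUnitaryGroup (Fin N) ℂ)) (hD : D.IsPrintedAveraged)
    (hB : B16.EndStatementBPrinted D.C) (Sβ : B12Beta.OneLoopSplit D.βfun) {Lc : ℕ} [NeZero Lc] (hLc : 2 ≤ Lc) {r : Fin (3 + 1) → ℕ}
    (hr : r ∈ box (3 + 1) Lc) (cE cVH cΛ cB : ℝ) (Tc : Fin 4 → Fin 4 → Fin 4 → Fin 4 → ℝ) (μ ν : Fin 4)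
    (hpin : ∀ j, Sβ.β0 j = B12Beta.secondMoment (TbalOf Lc (JsBalAn1 (one_le_of_two_le hLc) hr cE cVH cΛ ((Lc : ℝ) ^ (2 * (3 + 1))) cB Tc) j) μ ν)
    {γc : ℝ} (hES : EverySlope Sβ γc) (hcont : BetaContH γc D.βfun)
    (hpos : 0 < CauchyRate.lim fun j =>
      B12Beta.secondMoment (TbalOf Lc (JsBalAn1 (one_le_of_two_le hLc) hr cE cVH cΛ ((Lc : ℝ) ^ (2 * (3 + 1))) cB Tc) j) μ ν)
    (hNE : T4ApexHybrid.HybridNE7Under D (EndpointExistence D.C.toB12)) : ContinuumYM4Torus D ∧ ContinuumYM4TorusE D := by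
  obtain ⟨c₀, θ, hθ0, hθ1, hG⟩ := exists_geomRate_pinned hLc hr cE cVH cΛ cB Tc μ ν
  have hb : Sβ.β0 = fun j =>
      B12Beta.secondMoment (TbalOf Lc (JsBalAn1 (one_le_of_two_le hLc) hr cE cVH cΛ ((Lc : ℝ) ^ (2 * (3 + 1))) cB Tc) j) μ ν := funext hpin
  have hA := hG.drift hθ0 hθ1
  rw [← hb] at hA hpos
  exact continuumYM4Torus_of_slope_pos_everySlope D hD hB Sβ hES hA hpos hcont hNE

end DatumSU

end

end Summit.QuantumFields.BalabanUV.Gaps.EndDrawdownEverySlopeDecided
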